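import Literature.NumberTheory.EllipticCurves.DeuringSupersingularReductionProofs
import Literature.NumberTheory.EllipticCurves.BSDWave0TunnellProofs
import Literature.NumberTheory.EllipticCurves.BSDAnalyticRankTunnellCMProofs
import Literature.NumberTheory.EllipticCurves.DeuringSplitOrdinaryModelsProofs
import HarnessLib

/-!
# Deuring's criterion, supersingular half — the odd primes RAMIFIED in the CM field, over every
# number field

`Proofs` file (theorems only, no definitions, no named facts), topic `NumberTheory/EllipticCurves`;
second proofs sibling of `DeuringSupersingularReduction` (named fact
`deuring_not_hasUnitRootAt_of_hasCM_of_not_cmSplit`, Lang, *Elliptic Functions*, Ch. 13 §4 Thm. 12: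
"`Ā` is supersingular if … `p` ramifies or remains prime in `k`"), after
`DeuringSupersingularReductionProofs` (the maximal-order engine over `ℚ`; the case `p = 2`). Here:
**the case of an ODD prime `p` RAMIFIED in the CM field** (`p ∣ d_K`: `(d_K, p) ∈ {(−3, 3), (−7, 7),
(−11, 11), (−19, 19), (−43, 43), (−67, 67), (−163, 163)}`), along the `j`-invariant route
(HOME/b2b-bsdres-lit-bst/BST-BCST.md §14.4):

* `exists_j_eq_intCast_of_hasCM_of_cmRamified_odd` — from the table of the thirteen CM
  `j`-invariants (Silverman *AEC* App. C §11, *AT* App. A §3): for a CM curve `E/ℚ` and an odd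
  prime `p ∣ d_K`, `j(E) = n ∈ ℤ` with **`p ∣ n − 1728`** and **`p ≡ 3 (mod 4)`** (e.g.
  `−640320³ − 1728 = −163 · 1610658973256256`; Gross–Zagier's `j ≡ 1728`: the reduction at the
  ramified prime has `j̃ = 1728`);
* `natCast_dvd_frobeniusTrace_congruentNumberCurve_one_of_mod_four` — the comparison curve
  `y² = x³ − x` (`congruentNumberCurve 1`, globally minimal, `j = 1728`, `Δ = 64`, CM by `ℤ[i]`,
  `d = −4`) is supersingular at every `p ≡ 3 (mod 4)`: `−4` is a non-square mod `p`
  (`ZMod.exists_sq_eq_neg_one_iff`) and the maximal-order engine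
  `natCast_dvd_frobeniusTrace_of_mem_maximalCMJInvariants_of_not_isSquare` applies — at `p = 3`
  included (where Ireland–Rosen's point count `a_p = 0`, the tree's
  `frobeniusTrace_eq_zero_of_j_eq_of_mod_four_eq_three`, is stated for `p ≠ 3` only);
* `deuring_not_hasUnitRootAt_of_hasCM_of_cmRamified_odd` — **the ramified odd case of the named
  fact over every number field, PROVED**: `j(Ẽ_w) = n = 1728` in `k_w` (`ReductionAtJInvariantProofs`,
  `p ∣ n − 1728`), so by `char_dvd_trace_iff_of_j_eq_intCast` (supersingularity depends only on
  `(j̃, p)`) `Ẽ_w` is supersingular iff the reduction of `y² = x³ − x` mod `p` is, which it is.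

## References

* [Lang1987] S. Lang, *Elliptic Functions*, 2nd ed., GTM 112 (1987), Ch. 13 §4 Thm. 12.
* [SilvermanAEC2009] J. H. Silverman, *The Arithmetic of Elliptic Curves*, 2nd ed. (2009),
  App. C §11, V.3.1(a), V.4.1, VII.§2.
* [SilvermanAdvancedTopics1994] J. H. Silverman, *Advanced Topics*, GTM 151 (1994), App. A §3.
* [IrelandRosen1990] K. Ireland, M. Rosen, *A Classical Introduction to Modern Number Theory*,
  2nd ed., Ch. 18 §4 Thm. 5 (`y² = x³ − Dx`, `p ≡ 3 (4)`: `N_p = p + 1`).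

## Design

`noncomputable section`, `open scoped Classical NumberField`; `namespace
Literature.NumberTheory.EllipticCurves`; the conclusion is stated in exactly the binder shape of
the named fact restricted to `p ≠ 2 ∧ CMRamified E p`. Nothing is defined; no named fact is used as
a hypothesis (the discharged `Cox2013_…_holds`, `Silverman1994_…_holds`, `hasCM_iff_j_mem_holds`
enter through `DeuringSupersingularReductionProofs`).
-/

noncomputable section

open scoped Classical NumberField

open IsDedekindDomain NumberField WeierstrassCurve

namespace Literature.NumberTheory.EllipticCurves

open Rank1Residual DeuringModels

/-! ## The table: at an odd ramified prime, `j ≡ 1728 (mod p)` and `p ≡ 3 (mod 4)` -/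

/-- Two primes one of which divides the other (in `ℤ`) are equal (private helper). [folklore] -/
private theorem eq_of_prime_of_intCast_dvd {p q : ℕ} (hp : p.Prime) (hq : q.Prime)
    (h : (p : ℤ) ∣ (q : ℤ)) : p = q :=
  (Nat.prime_dvd_prime_iff_eq hp hq).mp (by exact_mod_cast h)

/-- **The CM `j`-invariants over `ℚ` at an odd ramified prime.** For a CM elliptic curve `E/ℚ`
(`j(E)` one of the thirteen values, Silverman *AEC* App. C §11 / *AT* App. A §3; the tree's
`hasCM_iff_j_mem_holds`) and an odd prime `p` dividing `d_K = cmFieldDiscrOfJ j(E)`: `p = −d_K ∈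
{3, 7, 11, 19, 43, 67, 163}`, `j(E) = n ∈ ℤ` with `p ∣ n − 1728`, and `p ≡ 3 (mod 4)` (the
thirteen numerical facts, e.g. `−3375 − 1728 = −7·729`, `−32768 − 1728 = −11·3136`,
`−262537412640768000 − 1728 = −163·1610658973256256`).
[cite: SilvermanAEC2009, App. C §11, Examples 11.3.1–11.3.2] [cite: SilvermanAdvancedTopics1994, App. A §3] -/
theorem exists_j_eq_intCast_of_hasCM_of_cmRamified_odd (E : WeierstrassCurve ℚ) [E.IsElliptic]
    (hCM : E.HasCM) {p : ℕ} (hp : p.Prime) (hp2 : p ≠ 2) (hram : CMRamified E p) :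
    ∃ n : ℤ, E.j = n ∧ (p : ℤ) ∣ n - 1728 ∧ p % 4 = 3 := by
  have hj := (hasCM_iff_j_mem_holds E).mp hCM
  unfold CMRamified at hram
  -- an odd prime dividing `4` or `8` does not exist
  have h2pow : ∀ k : ℕ, ¬ (p : ℤ) ∣ (2 : ℤ) ^ k := fun k h ↦
    hp2 ((Nat.prime_dvd_prime_iff_eq hp Nat.prime_two).mp
      (hp.dvd_of_dvd_pow (n := k) (by exact_mod_cast h)))
  simp only [cmJInvariants, Finset.mem_insert, Finset.mem_singleton] at hj
  rcases hj with h | h | h | h | h | h | h | h | h | h | h | h | h <;>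
    rw [h] at hram <;> norm_num [cmFieldDiscrOfJ] at hram
  · -- `j = 0`, `d = -3`
    obtain rfl := eq_of_prime_of_intCast_dvd hp Nat.prime_three hram
    exact ⟨0, by rw [h]; norm_num, by norm_num, by norm_num⟩
  · -- `j = 1728`, `d = -4`
    exact absurd hram (by simpa using h2pow 2)
  · -- `j = -3375`, `d = -7`
    obtain rfl := eq_of_prime_of_intCast_dvd hp (by norm_num) hram
    exact ⟨-3375, by rw [h]; norm_num, by norm_num, by norm_num⟩
  · -- `j = 8000`, `d = -8`
    exact absurd hram (by simpa using h2pow 3)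
  · -- `j = -32768`, `d = -11`
    obtain rfl := eq_of_prime_of_intCast_dvd hp (by norm_num) hram
    exact ⟨-32768, by rw [h]; norm_num, by norm_num, by norm_num⟩
  · -- `j = 54000`, `d = -3`
    obtain rfl := eq_of_prime_of_intCast_dvd hp Nat.prime_three hram
    exact ⟨54000, by rw [h]; norm_num, by norm_num, by norm_num⟩
  · -- `j = 287496`, `d = -4`
    exact absurd hram (by simpa using h2pow 2)
  · -- `j = -884736`, `d = -19`
    obtain rfl := eq_of_prime_of_intCast_dvd hp (by norm_num) hram
    exact ⟨-884736, by rw [h]; norm_num, by norm_num, by norm_num⟩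
  · -- `j = -12288000`, `d = -3`
    obtain rfl := eq_of_prime_of_intCast_dvd hp Nat.prime_three hram
    exact ⟨-12288000, by rw [h]; norm_num, by norm_num, by norm_num⟩
  · -- `j = 16581375`, `d = -7`
    obtain rfl := eq_of_prime_of_intCast_dvd hp (by norm_num) hram
    exact ⟨16581375, by rw [h]; norm_num, by norm_num, by norm_num⟩
  · -- `j = -884736000`, `d = -43`
    obtain rfl := eq_of_prime_of_intCast_dvd hp (by norm_num) hram
    exact ⟨-884736000, by rw [h]; norm_num, by norm_num, by norm_num⟩
  · -- `j = -147197952000`, `d = -67`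
    obtain rfl := eq_of_prime_of_intCast_dvd hp (by norm_num) hram
    exact ⟨-147197952000, by rw [h]; norm_num, by norm_num, by norm_num⟩
  · -- `j = -262537412640768000`, `d = -163`
    obtain rfl := eq_of_prime_of_intCast_dvd hp (by norm_num) hram
    exact ⟨-262537412640768000, by rw [h]; norm_num, by norm_num, by norm_num⟩

/-! ## The comparison curve `y² = x³ − x` is supersingular at every `p ≡ 3 (mod 4)` -/

/-- `−4` is a non-square modulo a prime `p ≡ 3 (mod 4)` (`−1` is not, first supplement to
quadratic reciprocity, Mathlib `ZMod.exists_sq_eq_neg_one_iff`; and `4 = 2²` is invertible).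
[folklore] -/
private theorem not_isSquare_neg_four_of_mod_four {p : ℕ} [Fact p.Prime] (hp4 : p % 4 = 3) :
    ¬ IsSquare (-4 : ZMod p) := by
  have hp : p.Prime := Fact.out
  have hp2 : p ≠ 2 := by rintro rfl; norm_num at hp4
  have h2 : (2 : ZMod p) ≠ 0 := by
    intro h0
    have h0' : ((2 : ℕ) : ZMod p) = 0 := by exact_mod_cast h0
    rw [ZMod.natCast_eq_zero_iff] at h0'
    exact hp2 ((Nat.prime_dvd_prime_iff_eq hp Nat.prime_two).mp h0')
  rintro ⟨r, hr⟩
  have hneg : IsSquare (-1 : ZMod p) := ⟨r / 2, by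
    field_simp
    linear_combination hr⟩
  exact (ZMod.exists_sq_eq_neg_one_iff.mp hneg) hp4

/-- **`y² = x³ − x` is supersingular at every prime `p ≡ 3 (mod 4)`: `p ∣ a_p`.** The curve
`congruentNumberCurve 1` is globally minimal (`isGloballyMinimal_congruentNumberCurve`) with
`j = 1728 ∈ maximalCMJInvariants` (CM by `ℤ[i]`, `d = cmDiscr 1728 = −4`) and `Δ = 64`, so every
odd `p` is good; for `p ≡ 3 (mod 4)` the discriminant `−4` is a non-square mod `p` and the
maximal-order engine (`natCast_dvd_frobeniusTrace_of_mem_maximalCMJInvariants_of_not_isSquare`: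
Deuring via Cox §14.B + Silverman *AT* II.4.4 + Lang Ch. 13 §2 Thm. 5(i)) gives `p ∣ a_p` — at
`p = 3` as well. (Ireland–Rosen Ch. 18 §4 Thm. 5: in fact `a_p = 0`.)
[cite: Lang1987, Ch. 13 §4 Thm. 12 (PDF p. 140)] [cite: IrelandRosen1990, Ch. 18 §4, Theorem 5] -/
theorem natCast_dvd_frobeniusTrace_congruentNumberCurve_one_of_mod_four (p : ℕ) [Fact p.Prime]
    (hp4 : p % 4 = 3) :
    haveI := isGloballyMinimal_congruentNumberCurve squarefree_one
    (p : ℤ) ∣ (congruentNumberCurve 1).frobeniusTrace p := by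
  have hp : p.Prime := Fact.out
  have hp2 : p ≠ 2 := by rintro rfl; norm_num at hp4
  haveI := isElliptic_congruentNumberCurve one_ne_zero
  haveI := isGloballyMinimal_congruentNumberCurve squarefree_one
  have hΔ : ¬ (p : ℤ) ∣ minimalDiscriminantInt (congruentNumberCurve 1) := by
    rw [minimalDiscriminantInt, integralModelInt_congruentNumberCurve]
    exact not_dvd_congruentNumberCurveInt_Δ_of_not_dvd hp (by
      rw [mul_one]; exact fun h ↦ hp2 ((Nat.prime_dvd_prime_iff_eq hp Nat.prime_two).mp h))
  refine natCast_dvd_frobeniusTrace_of_mem_maximalCMJInvariants_of_not_isSquare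
    (congruentNumberCurve 1) (congruentNumberCurve_j_mem_maximalCMJInvariants 1) p hΔ ?_
  rw [congruentNumberCurve_j]
  norm_num [cmDiscr]
  exact not_isSquare_neg_four_of_mod_four hp4

/-! ## The ramified odd case of the named fact, over every number field -/

/-- **Deuring's criterion (supersingular half) at an odd prime RAMIFIED in the CM field, over
every number field — that case of `deuring_not_hasUnitRootAt_of_hasCM_of_not_cmSplit`, PROVED.**
For an elliptic curve `E/ℚ` with complex multiplication, an odd prime `p ∣ d_K` (`CMRamified E p`),
a number field `F` and a finite place `w ∣ p` at which `E_F` has good reduction: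
`p ∣ #k_w + 1 − #Ẽ_w(k_w)`, i.e. `¬ HasUnitRootAt w`. Proof along the `j`-invariant route:
`j(E) = n` with `p ∣ n − 1728` and `p ≡ 3 (mod 4)` (the table); `j(Ẽ_w) = n` in `k_w`
(`j_reductionAt_baseChange_eq_intCast`); the reduction `V₀` of `y² = x³ − x` modulo `p` has
`j(V₀) = 1728 = n` in `𝔽_p` (`j_reductionModPrime`) and is supersingular
(`natCast_dvd_frobeniusTrace_congruentNumberCurve_one_of_mod_four`); and supersingularity over a
finite field depends only on `(j̃, p)` (`char_dvd_trace_iff_of_j_eq_intCast`, Silverman V.3.1(a) /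
V.4.1 with Mathlib's `exists_variableChange_of_j_eq`). Lang, Ch. 13 §4 Thm. 12, "`p` ramifies".
[cite: Lang1987, Ch. 13 §4 Thm. 12 (PDF p. 140)] [cite: SilvermanAEC2009, Thm. V.3.1(a) and VII.§2] -/
theorem deuring_not_hasUnitRootAt_of_hasCM_of_cmRamified_odd :
    ∀ (E : WeierstrassCurve ℚ) [E.IsElliptic], E.HasCM →
      ∀ (p : ℕ), p.Prime → p ≠ 2 → CMRamified E p →
      ∀ (F : Type) [Field F] [NumberField F] (w : HeightOneSpectrum (𝓞 F)),
        (p : 𝓞 F) ∈ w.asIdeal → (E.baseChange F).HasGoodReductionAt w →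
        ¬ (E.baseChange F).HasUnitRootAt w := by
  intro E _ hCM p hp hp2 hram F _ _ w hw hgood hunit
  haveI : Fact p.Prime := ⟨hp⟩
  obtain ⟨n, hjn, hdvd, hp4⟩ := exists_j_eq_intCast_of_hasCM_of_cmRamified_odd E hCM hp hp2 hram
  -- the reduction at `w` and its `j`
  haveI : ((E.baseChange F).reductionAt w).IsElliptic := isElliptic_reductionAt hgood
  have hjV : ((E.baseChange F).reductionAt w).j = n :=
    j_reductionAt_baseChange_eq_intCast E w hgood hjn
  have hchar : ringChar (IsLocalRing.ResidueField (w.adicCompletionIntegers F)) = p :=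
    ringChar_residueField_eq w hp hw
  haveI : CharP (IsLocalRing.ResidueField (w.adicCompletionIntegers F)) p := ringChar.of_eq hchar
  -- the comparison curve `y² = x³ - x` reduced mod `p`
  haveI := isElliptic_congruentNumberCurve one_ne_zero
  haveI := isGloballyMinimal_congruentNumberCurve squarefree_one
  have hΔ : ¬ (p : ℤ) ∣ minimalDiscriminantInt (congruentNumberCurve 1) := by
    rw [minimalDiscriminantInt, integralModelInt_congruentNumberCurve]
    exact not_dvd_congruentNumberCurveInt_Δ_of_not_dvd hp (by
      rw [mul_one]; exact fun h ↦ hp2 ((Nat.prime_dvd_prime_iff_eq hp Nat.prime_two).mp h))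
  haveI : (reductionModPrime (congruentNumberCurve 1) p).IsElliptic :=
    isElliptic_reductionModPrime (congruentNumberCurve 1) hΔ
  have hjV₀ : (reductionModPrime (congruentNumberCurve 1) p).j = n := by
    rw [j_reductionModPrime (congruentNumberCurve 1) 1728
      (by rw [congruentNumberCurve_j]; norm_num) hΔ]
    have h0 : (((n - 1728 : ℤ)) : ZMod p) = 0 :=
      (ZMod.intCast_zmod_eq_zero_iff_dvd (n - 1728) p).mpr hdvd
    push_cast at h0
    linear_combination -h0
  have hss₀ : (p : ℤ) ∣ (p : ℤ) + 1 -
      Nat.card (reductionModPrime (congruentNumberCurve 1) p).toAffine.Point := by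
    rw [← frobeniusTrace_eq_sub_natCard_reductionModPrime]
    exact natCast_dvd_frobeniusTrace_congruentNumberCurve_one_of_mod_four p hp4
  have hss := (((E.baseChange F).reductionAt w).char_dvd_trace_iff_of_j_eq_intCast p
    (reductionModPrime (congruentNumberCurve 1) p) hjV hjV₀).mpr hss₀
  refine (hasUnitRootAt_iff w (E.baseChange F)).mp hunit ?_
  rw [hchar]
  exact hss

end Literature.NumberTheory.EllipticCurves

end
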